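import Summits.QuantumAdvantage.AdviceFreeQNC0.BlockLemma
import HarnessLib

/-!
# Cell qa-qnc0, `p = 3` — DEFECT CALCULUS on the bond-twisted register chain (planner qa-qnc0-p1 g20, ask P-20e′;
ROUND-19 §3 addendum 02:02Z; `exp20/Sketch20x.lean` §8)

The bookkeeping behind the QUANTITATIVE block lemma (`BlockLemmaQuant.lean`):
* `bsum k H` — sum over all bit strings of length `k`; `sum_bsum_run`: `Σ_σ Σ_{|w|=k} G(σ·w) = 2^k Σ_τ G τ`
  (each reading step is exactly 2-to-1, `sum_nextState`); `sum_flipSpin` (spin-flip re-indexing);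
* `sdef`, `pathErr`, `pathErrSq`, `chainDefect` — stage / path / total `ℓ²` alignment defects of a chain of site operators;
* `rnsq_chainOp_add_defect_le` — telescoped defect `rnsq (chain f) + ¼ chainDefect ≤ rnsq f`;
* `pathErr_sq_le` — Cauchy–Schwarz along a path, `pathErr² ≤ (m/4) pathErrSq`;
* `sum_bsum_pathErrSq` — `Σ_σ Σ_w pathErrSq(σ,w) = 2^m chainDefect`;
* `chainOp_approx` — TRANSPORT WITH ERROR: `|(T_0⋯T_m f)(σ) − Φ_w θ f(σ·w)| ≤ pathErr(σ,w)`, `θ = ±1`.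

WHAT THIS IS NOT: no norm bound by itself; crux 22907 untouched; separation NOT moved.
-/

namespace Summit.QuantumAdvantage.AdviceFreeQNC0

open Finset Literature.Computability.QuantumComplexity

namespace BondTwist3

variable {r : ℕ}

/-! ## Sums over bit strings -/

/-- `bsum k H = Σ_{w ∈ {0,1}^k} H w` (bit strings as lists). -/
def bsum : ℕ → (List Bool → ℝ) → ℝ
  | 0, H => H []
  | k + 1, H => bsum k (fun bs => H (false :: bs)) + bsum k (fun bs => H (true :: bs))

/-- Linearity. -/
theorem bsum_add (k : ℕ) : ∀ H₁ H₂ : List Bool → ℝ, bsum k (fun bs => H₁ bs + H₂ bs) = bsum k H₁ + bsum k H₂ := by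
  induction k with
  | zero => intro H₁ H₂; rfl
  | succ k ih => intro H₁ H₂; simp only [bsum]; rw [ih, ih]; ring

/-- Constants. -/
theorem bsum_const (k : ℕ) (c : ℝ) : bsum k (fun _ => c) = 2 ^ k * c := by
  induction k with
  | zero => simp [bsum]
  | succ k ih => simp only [bsum]; rw [ih]; ring

/-- Scalars. -/
theorem bsum_const_mul (k : ℕ) : ∀ (c : ℝ) (H : List Bool → ℝ), bsum k (fun bs => c * H bs) = c * bsum k H := by
  induction k with
  | zero => intro c H; rfl
  | succ k ih => intro c H; simp only [bsum]; rw [ih, ih]; ring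

/-- Monotonicity (only strings of length `k` matter). -/
theorem bsum_mono (k : ℕ) : ∀ H₁ H₂ : List Bool → ℝ, (∀ bs, bs.length = k → H₁ bs ≤ H₂ bs) →
    bsum k H₁ ≤ bsum k H₂ := by
  induction k with
  | zero => intro H₁ H₂ h; exact h [] rfl
  | succ k ih =>
    intro H₁ H₂ h
    simp only [bsum]
    exact add_le_add (ih _ _ fun bs hbs => h _ (by simp [hbs])) (ih _ _ fun bs hbs => h _ (by simp [hbs]))

/-- **Re-indexing**: `Σ_σ Σ_{|w| = k} G(σ·w) = 2^k Σ_τ G τ` (each step `(σ, b) ↦ σ·b` is 2-to-1). -/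
theorem sum_bsum_run (k : ℕ) : ∀ G : RegState r → ℝ,
    ∑ σ : RegState r, bsum k (fun bs => G (run σ bs)) = 2 ^ k * ∑ τ : RegState r, G τ := by
  induction k with
  | zero => intro G; simp [bsum, run_nil]
  | succ k ih =>
    intro G
    simp only [bsum, run_cons]
    rw [sum_nextState (fun τ => bsum k fun bs => G (run τ bs)), ih G]
    ring

/-- The spin flip `(S, s, reg) ↦ (S, ¬s, reg)`. -/
def flipSpin (σ : RegState r) : RegState r := (σ.1, !σ.2.1, σ.2.2)

/-- Re-indexing by the spin flip. -/
theorem sum_flipSpin (G : RegState r → ℝ) : ∑ σ : RegState r, G (flipSpin σ) = ∑ σ : RegState r, G σ := by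
  have hinv : Function.Involutive (flipSpin (r := r)) := by
    rintro ⟨S, s, reg⟩; simp [flipSpin]
  exact Equiv.sum_comp (Equiv.ofBijective _ hinv.bijective) G

/-! ## Defects along a chain -/

/-- The alignment defect of the stage `p` acting on `g`, at the state `σ`. -/
noncomputable def sdef (p : ℂ × (RegState r → Bool → Bool)) (g : RegState r → ℂ) (σ : RegState r) : ℝ :=
  ‖brL p.2 g σ - brR p.1 p.2 g σ‖

/-- Accumulated (halved) defects along the path `w` from `σ`. -/
noncomputable def pathErr : List (ℂ × (RegState r → Bool → Bool)) → (RegState r → ℂ) → RegState r → List Bool → ℝ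
  | p :: l, f, σ, b :: bs => sdef p (chainOp l f) σ / 2 + pathErr l f (nextState σ b) bs
  | _, _, _, _ => 0

/-- Accumulated squared defects along the path `w` from `σ`. -/
noncomputable def pathErrSq :
    List (ℂ × (RegState r → Bool → Bool)) → (RegState r → ℂ) → RegState r → List Bool → ℝ
  | p :: l, f, σ, b :: bs => sdef p (chainOp l f) σ ^ 2 + pathErrSq l f (nextState σ b) bs
  | _, _, _, _ => 0

/-- Total `ℓ²` defect of the chain: `Σ_j Σ_σ d_j(σ)²`. -/
noncomputable def chainDefect : List (ℂ × (RegState r → Bool → Bool)) → (RegState r → ℂ) → ℝ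
  | [], _ => 0
  | p :: l, f => (∑ σ : RegState r, sdef p (chainOp l f) σ ^ 2) + chainDefect l f

/-- `pathErr ≥ 0`. -/
theorem pathErr_nonneg (l : List (ℂ × (RegState r → Bool → Bool))) (f : RegState r → ℂ) :
    ∀ (σ : RegState r) (bs : List Bool), 0 ≤ pathErr l f σ bs := by
  induction l with
  | nil => intro σ bs; cases bs <;> simp [pathErr]
  | cons p l ih =>
    intro σ bs
    cases bs with
    | nil => simp [pathErr]
    | cons b bs => simp only [pathErr]; exact add_nonneg (by unfold sdef; positivity) (ih _ _)

/-- `pathErrSq ≥ 0`. -/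
theorem pathErrSq_nonneg (l : List (ℂ × (RegState r → Bool → Bool))) (f : RegState r → ℂ) :
    ∀ (σ : RegState r) (bs : List Bool), 0 ≤ pathErrSq l f σ bs := by
  induction l with
  | nil => intro σ bs; cases bs <;> simp [pathErrSq]
  | cons p l ih =>
    intro σ bs
    cases bs with
    | nil => simp [pathErrSq]
    | cons b bs => simp only [pathErrSq]; exact add_nonneg (by positivity) (ih _ _)

/-- **Telescoped defect**: `rnsq (chain f) + ¼ chainDefect ≤ rnsq f`. -/
theorem rnsq_chainOp_add_defect_le (l : List (ℂ × (RegState r → Bool → Bool))) (hl : ∀ p ∈ l, ‖p.1‖ ≤ 1)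
    (f : RegState r → ℂ) : rnsq (chainOp l f) + chainDefect l f / 4 ≤ rnsq f := by
  induction l with
  | nil => simp [chainOp_nil, chainDefect]
  | cons p l ih =>
    rw [chainOp_cons]
    simp only [chainDefect]
    have h1 := rnsq_siteOpR_add_defect_le (hl p (by simp)) p.2 (chainOp l f)
    have h2 := ih fun q hq => hl q (by simp [hq])
    simp only [sdef]
    linarith

/-- **Cauchy–Schwarz along a path**: `pathErr² ≤ (m/4)·pathErrSq`, `m` the chain length. -/
theorem pathErr_sq_le (l : List (ℂ × (RegState r → Bool → Bool))) (f : RegState r → ℂ) :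
    ∀ (σ : RegState r) (bs : List Bool), pathErr l f σ bs ^ 2 ≤ (l.length : ℝ) / 4 * pathErrSq l f σ bs := by
  induction l with
  | nil => intro σ bs; cases bs <;> simp [pathErr, pathErrSq]
  | cons p l ih =>
    intro σ bs
    cases bs with
    | nil => simp [pathErr, pathErrSq]
    | cons b bs =>
      simp only [pathErr, pathErrSq, List.length_cons, Nat.cast_succ]
      set a := sdef p (chainOp l f) σ
      set P := pathErr l f (nextState σ b) bs
      set Q := pathErrSq l f (nextState σ b) bs
      set k : ℝ := (l.length : ℝ)
      have hP : 0 ≤ P := pathErr_nonneg _ _ _ _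
      have hQ : 0 ≤ Q := pathErrSq_nonneg _ _ _ _
      have ha : 0 ≤ a := by simp only [a, sdef]; positivity
      have hk : 0 ≤ k := by positivity
      have hPQ : P ^ 2 ≤ k / 4 * Q := ih _ _
      -- `k·G = (k a − 2P)² + (k+1)(kQ − 4P²) ≥ 0`, and the case `k = 0` forces `P = 0`
      have hkG : 0 ≤ k * ((k + 1) / 4 * (a ^ 2 + Q) - (a / 2 + P) ^ 2) := by
        nlinarith [sq_nonneg (k * a - 2 * P), mul_nonneg (by positivity : (0 : ℝ) ≤ k + 1) (by nlinarith : 0 ≤ k * Q - 4 * P ^ 2)]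
      rcases hk.lt_or_eq with hk0 | hk0
      · by_contra hcon
        push Not at hcon
        exact absurd hkG (not_le.2 (mul_neg_of_pos_of_neg hk0 (sub_neg.2 hcon)))
      · have hP0 : P = 0 := by
          have : P ^ 2 ≤ 0 := by rw [← hk0] at hPQ; simpa using hPQ
          nlinarith
        rw [hP0, ← hk0]
        nlinarith

/-- **Re-indexing of the path defects**: `Σ_σ Σ_{|w| = m} pathErrSq(σ, w) = 2^m · chainDefect`. -/
theorem sum_bsum_pathErrSq (l : List (ℂ × (RegState r → Bool → Bool))) (f : RegState r → ℂ) :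
    ∑ σ : RegState r, bsum l.length (pathErrSq l f σ) = 2 ^ l.length * chainDefect l f := by
  induction l with
  | nil => simp [bsum, pathErrSq, chainDefect]
  | cons p l ih =>
    simp only [List.length_cons, bsum, pathErrSq, chainDefect]
    have hsplit : ∀ (σ : RegState r) (b : Bool),
        bsum l.length (fun bs => sdef p (chainOp l f) σ ^ 2 + pathErrSq l f (nextState σ b) bs) =
          2 ^ l.length * sdef p (chainOp l f) σ ^ 2 + bsum l.length (pathErrSq l f (nextState σ b)) := by
      intro σ b
      rw [bsum_add l.length (fun _ => sdef p (chainOp l f) σ ^ 2) (pathErrSq l f (nextState σ b)), bsum_const]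
    simp_rw [hsplit]
    have hre := sum_nextState (fun τ : RegState r => bsum l.length (pathErrSq l f τ))
    rw [ih] at hre
    rw [show (∑ σ : RegState r, (2 ^ l.length * sdef p (chainOp l f) σ ^ 2 + bsum l.length (pathErrSq l f (nextState σ false)) +
        (2 ^ l.length * sdef p (chainOp l f) σ ^ 2 + bsum l.length (pathErrSq l f (nextState σ true))))) =
        2 * 2 ^ l.length * (∑ σ : RegState r, sdef p (chainOp l f) σ ^ 2) +
          ∑ σ : RegState r, (bsum l.length (pathErrSq l f (nextState σ false)) +
            bsum l.length (pathErrSq l f (nextState σ true))) by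
      rw [mul_sum, ← sum_add_distrib]; exact sum_congr rfl fun σ _ => by ring]
    rw [hre]
    ring

/-! ## Transport with error -/

/-- Unimodular phases give a unimodular product. -/
theorem norm_phaseProd (l : List (ℂ × (RegState r → Bool → Bool))) (hl : ∀ p ∈ l, ‖p.1‖ = 1) (bs : List Bool) :
    ‖phaseProd l bs‖ = 1 := by
  induction l generalizing bs with
  | nil => cases bs <;> simp [phaseProd]
  | cons p l ih =>
    cases bs with
    | nil => simp [phaseProd]
    | cons b bs =>
      simp only [phaseProd, norm_mul]
      rw [ih (fun q hq => hl q (by simp [hq])) bs, mul_one]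
      cases b
      · simp
      · simpa using hl p (by simp)

/-- **Transport with error**: `|(T_0⋯T_m f)(σ) − Φ_w·θ·f(σ·w)| ≤ pathErr`, `θ = ±1`. -/
theorem chainOp_approx (l : List (ℂ × (RegState r → Bool → Bool))) (hl : ∀ p ∈ l, ‖p.1‖ ≤ 1)
    (f : RegState r → ℂ) (σ : RegState r) (bs : List Bool) (hlen : bs.length = l.length) :
    ∃ θ : ℂ, (θ = 1 ∨ θ = -1) ∧ ‖chainOp l f σ - phaseProd l bs * θ * f (run σ bs)‖ ≤ pathErr l f σ bs := by
  induction l generalizing σ bs with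
  | nil =>
    cases bs with
    | nil => exact ⟨1, Or.inl rfl, by simp [chainOp_nil, phaseProd, run_nil, pathErr]⟩
    | cons b bs => simp at hlen
  | cons p l ih =>
    cases bs with
    | nil => simp at hlen
    | cons b bs =>
      have hlen' : bs.length = l.length := by simpa using hlen
      obtain ⟨θ', hθ', e'⟩ := ih (fun q hq => hl q (by simp [hq])) (nextState σ b) bs hlen'
      have hp : ‖p.1‖ ≤ 1 := hl p (by simp)
      have hE := pathErr_nonneg l f (nextState σ b) bs
      cases b with
      | false =>
        refine ⟨(if p.2 σ false then (-1 : ℂ) else 1) * θ', ?_, ?_⟩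
        · rcases sgn_cases (p.2 σ false) with h | h <;> rcases hθ' with rfl | rfl <;> simp [h]
        · have hid : chainOp (p :: l) f σ - phaseProd (p :: l) (false :: bs) *
              ((if p.2 σ false then (-1 : ℂ) else 1) * θ') * f (run σ (false :: bs)) =
              (if p.2 σ false then (-1 : ℂ) else 1) *
                (chainOp l f (nextState σ false) - phaseProd l bs * θ' * f (run (nextState σ false) bs)) -
              (brL p.2 (chainOp l f) σ - brR p.1 p.2 (chainOp l f) σ) / 2 := by
            rw [chainOp_cons, siteOpR_apply, run_cons]
            simp only [phaseProd, Bool.false_eq_true, if_false, brL]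
            ring
          rw [hid]
          refine (norm_sub_le _ _).trans ?_
          rw [norm_mul, norm_sgn, one_mul, norm_div, Complex.norm_two]
          simp only [pathErr, sdef]
          linarith
      | true =>
        refine ⟨(if p.2 σ true then (-1 : ℂ) else 1) * θ', ?_, ?_⟩
        · rcases sgn_cases (p.2 σ true) with h | h <;> rcases hθ' with rfl | rfl <;> simp [h]
        · have hid : chainOp (p :: l) f σ - phaseProd (p :: l) (true :: bs) *
              ((if p.2 σ true then (-1 : ℂ) else 1) * θ') * f (run σ (true :: bs)) =
              p.1 * (if p.2 σ true then (-1 : ℂ) else 1) *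
                (chainOp l f (nextState σ true) - phaseProd l bs * θ' * f (run (nextState σ true) bs)) +
              (brL p.2 (chainOp l f) σ - brR p.1 p.2 (chainOp l f) σ) / 2 := by
            rw [chainOp_cons, siteOpR_apply, run_cons]
            simp only [phaseProd, if_true, brR]
            ring
          rw [hid]
          refine (norm_add_le _ _).trans ?_
          rw [norm_mul, norm_mul, norm_sgn, mul_one, norm_div, Complex.norm_two]
          simp only [pathErr, sdef]
          have := mul_le_of_le_one_left (norm_nonneg
            (chainOp l f (nextState σ true) - phaseProd l bs * θ' * f (run (nextState σ true) bs))) hp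
          linarith

end BondTwist3

end Summit.QuantumAdvantage.AdviceFreeQNC0
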